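import Summits.ValiantsHypothesis.ValiantsHypothesis.Theorems.LacunarySymmetroidMatrixDescartesCensusDoorA34EqualDiagonalChart

/-!
# `MatrixDescartes` census — DOOR A at `(3,4)`: the HOLLOW-CORNER CHART — every real symmetric `(3,4)` net whose annihilator
# contains a REAL LINE PAIR (with non-isotropic vertex) is congruent to `[[ε₁u+ε₂w, α, β], [α, u, 0], [β, 0, w]]`; one chart for
# all three node classes R4 / R2 / R0

HONEST FRAMING.  Object-search cell `pub-symmetroid`, door-A seat `val-sym-door-p3` (g17); item stmt-ValiantsHypothesis-19980
`DoorA34 = PosRootLawAt 3 4 18` (route item `Theses.LacunarySymmetroid.DoorA34`) is OPEN and asserted nowhere in this file.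
Nothing here bounds `ζ_sym(3,4)`; nothing bears on `MatrixDescartes` (stmt-ValiantsHypothesis-18050) or on `VP ≠ VNP`.

CONTENT (all supports — no exponent enters; no `def`, no `sorry`).  Companion of `…CensusDoorA34EqualDiagonalChart{,Rows}` (the
signed-equal-diagonal chart of the REALLY-SPLIT sector R4 ∪ R0).  Here the datum is weaker and covers the majority class R2 as well:
the annihilator (trace pairing) of the net `span{S₀,…,S₃} ⊂ Sym₃(ℝ)` contains a symmetric `B₁` and a REAL LINE PAIR
`K = m nᵀ + n mᵀ` — i.e. `tr(B₁S_l) = 0` and `mᵀ S_l n = 0` for every letter (the points `[m], [n]` are conjugate for every conic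
of the net) — whose vertex `v = m × n` is not `B₁`-isotropic: `a := vᵀB₁v ≠ 0`.
* §5 `det_hollowCorner` (`= uw(ε₁u+ε₂w) − α²w − β²u`) and its three sign classes: `det_hollowCorner_R4` (`ε = (1,1)`:
  `w(u²−α²) + u(w²−β²) = ½·e₃(u−α,u+α,w−β,w+β)`, the PAIR chart of `…NodeForm`), `det_hollowCorner_R2` (`ε = (1,−1)`:
  `w(u²−α²) − u(w²+β²)`, two real nodes and a conjugate pair, cf. `…NodeFormComplex.det_twoReal_oneConjPair`), `det_hollowCorner_R0`
  (`ε = (−1,−1)`: `−(w(u²+α²) + u(w²+β²))`, cf. `…NodeFormComplex.det_twoConjPairs`); `exists_sign_mul_sq`;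
  **`exists_congr_hollowCorner_of_frame`** — the chart from an explicit FRAME `(v, w₁, w₂)` (`Kv = 0`, `vᵀB₁v ≠ 0`, `wᵢ ⊥_{B₁} v`,
  `wᵢ` isotropic for `K`, `w₁ᵀKw₂ ≠ 0`): ONE congruence `S_l = Pᵀ [[ε₁u_l+ε₂w_l, α_l, β_l], [α_l, u_l, 0], [β_l, 0, w_l]] P`,
  `εᵢ ∈ {1, 0, −1}` fixed (an `εᵢ = 0` only on isotropic strata);
* §6 `trace_linePair_mul`, `isSymm_linePair`, **`exists_congr_hollowCorner`** — the frame is EXPLICIT from the line-pair presentation: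
  `v = m × n`, `w₁ = (B₁v) × m`, `w₂ = (B₁v) × n`, with `det[v,w₁,w₂] = a²` and `w₁ᵀKw₂ = −a²` (cross-product identities);
* §7 census form: `card_posRoots_eq_hollowCorner` (on every `d` the census count of such a pencil equals that of a hollow-corner pencil),
  `card_posRoots_le_of_hollowCorner_rows` (the Door-A row on this sector follows from the rows of the sixteen-parameter chart family),
  `hollowCorner_rows_of_posRootLawOn` (converse: chart pencils are symmetric pencils).
What is NOT here: that EVERY generic net admits such `(B₁, m, n)` (it does — the degenerate members of the annihilator pencil at real
parameters carrying a real line pair: three for R4, one for R2 and for R0 — standard, unproved in the kernel), density, openness.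
[folklore] Pencils of conics / pairs of real quadratic forms; Cayley's four-nodal cubic symmetroid; elementary.
-/

-- `Summit.ValiantsHypothesis.ValiantsHypothesis.…` repeats a component by the D-0017 layout
-- (single-conjunct summit), which the `dupNamespace` linter flags; the name is mandated.
set_option linter.dupNamespace false

namespace Summit.ValiantsHypothesis.ValiantsHypothesis.Theorems.LacunarySymmetroidMatrixDescartes.Census.EqualDiagonal

open Polynomial Matrix Finset
open scoped BigOperators

/-! ## 5. The hollow-corner chart from ONE real line-pair member of the annihilator pencil (all node classes) -/

/-- Determinant of the HOLLOW-CORNER chart matrix `[[ε₁u+ε₂w, α, β], [α, u, 0], [β, 0, w]]` (any commutative ring):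
`uw(ε₁u+ε₂w) − α²w − β²u`. [folklore] -/
theorem det_hollowCorner {R : Type*} [CommRing R] (ε₁ ε₂ u w α β : R) :
    (!![ε₁ * u + ε₂ * w, α, β; α, u, 0; β, 0, w]).det = u * w * (ε₁ * u + ε₂ * w) - α ^ 2 * w - β ^ 2 * u := by
  simp [Matrix.det_fin_three]
  ring

/-- Class R4 of the hollow-corner chart (`ε = (1,1)`): `det = w(u² − α²) + u(w² − β²) = ½·e₃(u−α, u+α, w−β, w+β)` — Cayley's
`e₃` on the four real node nomials (the cell's PAIR chart `ab(ε₁+ε₂) + ε₁ε₂(a+b)` of `…NodeForm`). [folklore] -/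
theorem det_hollowCorner_R4 {R : Type*} [CommRing R] (u w α β : R) :
    (!![u + w, α, β; α, u, 0; β, 0, w]).det = w * (u ^ 2 - α ^ 2) + u * (w ^ 2 - β ^ 2) ∧
    2 * (!![u + w, α, β; α, u, 0; β, 0, w]).det
      = (u - α) * (u + α) * (w - β) + (u - α) * (u + α) * (w + β) + (u - α) * (w - β) * (w + β) + (u + α) * (w - β) * (w + β) := by
  constructor <;> · simp [Matrix.det_fin_three]; ring

/-- Class R2 (`ε = (1,−1)`): `det = w(u² − α²) − u(w² + β²)` — two real node nomials `u ± α` and the conjugate pair `w ± iβ`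
(the shape `pqr + (p+q)(r²+s²)` of `…NodeFormComplex.det_twoReal_oneConjPair`, up to signs). [folklore] -/
theorem det_hollowCorner_R2 {R : Type*} [CommRing R] (u w α β : R) :
    (!![u - w, α, β; α, u, 0; β, 0, w]).det = w * (u ^ 2 - α ^ 2) - u * (w ^ 2 + β ^ 2) := by
  simp [Matrix.det_fin_three]
  ring

/-- Class R0 (`ε = (−1,−1)`): `det = −(w(u² + α²) + u(w² + β²))` — two conjugate pairs `u ± iα`, `w ± iβ`
(the shape `|m|²·Re(γℓ) + |ℓ|²·Re(δm)` of `…NodeFormComplex.det_twoConjPairs`). [folklore] -/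
theorem det_hollowCorner_R0 {R : Type*} [CommRing R] (u w α β : R) :
    (!![-u - w, α, β; α, u, 0; β, 0, w]).det = -(w * (u ^ 2 + α ^ 2) + u * (w ^ 2 + β ^ 2)) := by
  simp [Matrix.det_fin_three]
  ring

/-- Every real number is `ε·d²` with `ε ∈ {1, 0, −1}` and `d > 0`. [folklore] -/
theorem exists_sign_mul_sq (p : ℝ) : ∃ (ε d : ℝ), (ε = 1 ∨ ε = 0 ∨ ε = -1) ∧ 0 < d ∧ p = ε * d ^ 2 := by
  rcases lt_trichotomy p 0 with h | h | h
  · refine ⟨-1, Real.sqrt (-p), Or.inr (Or.inr rfl), Real.sqrt_pos.mpr (by linarith), ?_⟩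
    rw [Real.sq_sqrt (by linarith)]; ring
  · exact ⟨0, 1, Or.inr (Or.inl rfl), one_pos, by rw [h]; ring⟩
  · refine ⟨1, Real.sqrt p, Or.inl rfl, Real.sqrt_pos.mpr h, ?_⟩
    rw [Real.sq_sqrt h.le]; ring

/-- **THE HOLLOW-CORNER CHART (frame version; ALL node classes, all supports).**  Let the real symmetric letters `S₀,…,S₃` be
annihilated (trace pairing) by two symmetric matrices `B₁` and `K`, where `K` is a REAL LINE-PAIR member of the annihilator pencil,
witnessed by a FRAME `v, w₁, w₂` (rows of an invertible `V`): `K v = 0`, `vᵀB₁v ≠ 0`, `w₁, w₂ ⊥_{B₁} v`, `w₁, w₂` isotropic for `K`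
with `w₁ᵀ K w₂ ≠ 0`.  Then ONE congruence brings every letter to HOLLOW-CORNER form
`S_l = Pᵀ [[ε₁u_l + ε₂w_l, α_l, β_l], [α_l, u_l, 0], [β_l, 0, w_l]] P` with fixed `ε₁, ε₂ ∈ {1, 0, −1}`
(generic nets: `(ε₁,ε₂) = (1,1)` R4, `(1,−1)`/`(−1,1)` R2, `(−1,−1)` R0; an `εᵢ = 0` only on the isotropic strata).
Existence of the frame (one real generalised eigenvalue whose degenerate conic is a real line pair — always available for a
generic net: all three for R4, exactly one for R2 and for R0) is standard linear algebra and is NOT proved in this file. [folklore] -/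
theorem exists_congr_hollowCorner_of_frame (S : Fin 4 → Matrix (Fin 3) (Fin 3) ℝ) (hS : ∀ l, (S l).IsSymm)
    (B₁ K : Matrix (Fin 3) (Fin 3) ℝ) (hB₁ : B₁.IsSymm) (hK : K.IsSymm)
    (hann₁ : ∀ l, (B₁ * S l).trace = 0) (hannK : ∀ l, (K * S l).trace = 0)
    (v w₁ w₂ : Fin 3 → ℝ) (hV : (Matrix.of ![v, w₁, w₂]).det ≠ 0)
    (hKv : K *ᵥ v = 0) (ha : v ⬝ᵥ (B₁ *ᵥ v) ≠ 0) (hw₁ : v ⬝ᵥ (B₁ *ᵥ w₁) = 0) (hw₂ : v ⬝ᵥ (B₁ *ᵥ w₂) = 0)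
    (hiso₁ : w₁ ⬝ᵥ (K *ᵥ w₁) = 0) (hiso₂ : w₂ ⬝ᵥ (K *ᵥ w₂) = 0) (hκ : w₁ ⬝ᵥ (K *ᵥ w₂) ≠ 0) :
    ∃ (P : Matrix (Fin 3) (Fin 3) ℝ) (ε₁ ε₂ : ℝ) (u w α β : Fin 4 → ℝ), P.det ≠ 0 ∧
      (ε₁ = 1 ∨ ε₁ = 0 ∨ ε₁ = -1) ∧ (ε₂ = 1 ∨ ε₂ = 0 ∨ ε₂ = -1) ∧
      ∀ l, S l = Pᵀ * !![ε₁ * u l + ε₂ * w l, α l, β l; α l, u l, 0; β l, 0, w l] * P := by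
  -- symmetric matrices: `x ⬝ (B y) = y ⬝ (B x)`
  have hsy : ∀ {B : Matrix (Fin 3) (Fin 3) ℝ}, B.IsSymm → ∀ x y : Fin 3 → ℝ, x ⬝ᵥ (B *ᵥ y) = y ⬝ᵥ (B *ᵥ x) :=
    fun hB x y => by rw [Matrix.dotProduct_mulVec, ← Matrix.mulVec_transpose, hB.eq, dotProduct_comm]
  set f : Fin 3 → Fin 3 → ℝ := ![v, w₁, w₂] with hfdef
  set V : Matrix (Fin 3) (Fin 3) ℝ := Matrix.of f with hVdef
  have hf0 : f 0 = v := rfl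
  have hf1 : f 1 = w₁ := rfl
  have hf2 : f 2 = w₂ := rfl
  -- the two Gram matrices in the frame
  set κ := w₁ ⬝ᵥ (K *ᵥ w₂) with hκdef
  have hVK : V * K * Vᵀ = !![0, 0, 0; 0, 0, κ; 0, κ, 0] := by
    ext i j
    rw [hVdef, of_mul_mul_transpose_apply]
    have hKv' : ∀ x : Fin 3 → ℝ, x ⬝ᵥ (K *ᵥ v) = 0 := fun x => by rw [hKv, dotProduct_zero]
    have hvK' : ∀ x : Fin 3 → ℝ, v ⬝ᵥ (K *ᵥ x) = 0 := fun x => by rw [hsy hK, hKv']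
    fin_cases i <;> fin_cases j <;> simp [hf0, hf1, hf2, hKv', hvK', hiso₁, hiso₂, hκdef, hsy hK w₂ w₁]
  set a := v ⬝ᵥ (B₁ *ᵥ v) with hadef
  set b₂ := w₁ ⬝ᵥ (B₁ *ᵥ w₁) with hb₂def
  set b₃ := w₂ ⬝ᵥ (B₁ *ᵥ w₂) with hb₃def
  set b₂₃ := w₁ ⬝ᵥ (B₁ *ᵥ w₂) with hb₂₃def
  have hVB : V * B₁ * Vᵀ = !![a, 0, 0; 0, b₂, b₂₃; 0, b₂₃, b₃] := by
    ext i j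
    rw [hVdef, of_mul_mul_transpose_apply]
    have hw₁' : w₁ ⬝ᵥ (B₁ *ᵥ v) = 0 := by rw [hsy hB₁, hw₁]
    have hw₂' : w₂ ⬝ᵥ (B₁ *ᵥ v) = 0 := by rw [hsy hB₁, hw₂]
    fin_cases i <;> fin_cases j <;> simp [hf0, hf1, hf2, hw₁, hw₂, hw₁', hw₂', hadef, hb₂def, hb₃def, hb₂₃def, hsy hB₁ w₂ w₁]
  -- pull the letters back: `X_l = V⁻ᵀ S_l V⁻¹`, `S_l = Vᵀ X_l V`
  have hVdet : V.det ≠ 0 := hV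
  have hVunit : IsUnit V.det := isUnit_iff_ne_zero.mpr hVdet
  have hWV : V⁻¹ * V = 1 := Matrix.nonsing_inv_mul V hVunit
  set X : Fin 4 → Matrix (Fin 3) (Fin 3) ℝ := fun l => (V⁻¹)ᵀ * S l * V⁻¹ with hXdef
  have hSX : ∀ l, S l = Vᵀ * X l * V := by
    intro l
    calc S l = (V⁻¹ * V)ᵀ * S l * (V⁻¹ * V) := by rw [hWV, transpose_one, Matrix.one_mul, Matrix.mul_one]
      _ = Vᵀ * X l * V := by rw [hXdef, transpose_mul]; simp only [Matrix.mul_assoc]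
  have htr : ∀ (B : Matrix (Fin 3) (Fin 3) ℝ) l, (V * B * Vᵀ * X l).trace = (B * S l).trace := by
    intro B l
    rw [hSX l]
    calc (V * B * Vᵀ * X l).trace = (V * (B * Vᵀ * X l)).trace := by simp only [Matrix.mul_assoc]
      _ = ((B * Vᵀ * X l) * V).trace := Matrix.trace_mul_comm _ _
      _ = (B * (Vᵀ * X l * V)).trace := by simp only [Matrix.mul_assoc]
  have hXsymm : ∀ l i j, X l i j = X l j i := by
    intro l i j
    have hT : (X l)ᵀ = X l := by
      rw [hXdef]
      simp only
      rw [transpose_mul, transpose_mul, transpose_transpose, (hS l).eq]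
      simp only [Matrix.mul_assoc]
    have h := congrFun (congrFun hT i) j
    rw [transpose_apply] at h
    exact h.symm
  -- the corner entry vanishes
  have hX12 : ∀ l, X l 1 2 = 0 := by
    intro l
    have h := htr K l
    rw [hannK, hVK] at h
    simp [Matrix.trace, Matrix.vecMul, dotProduct, Fin.sum_univ_three] at h
    rw [hXsymm l 2 1] at h
    have hκ0 : κ ≠ 0 := hκ
    have : κ * (2 * X l 1 2) = 0 := by linarith
    have := (mul_eq_zero.mp this).resolve_left hκ0
    linarith
  -- the (0,0) entry is a fixed combination of the other two diagonal entries
  have hX00 : ∀ l, X l 0 0 = (-b₂ / a) * X l 1 1 + (-b₃ / a) * X l 2 2 := by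
    intro l
    have h := htr B₁ l
    rw [hann₁, hVB] at h
    simp [Matrix.trace, Matrix.vecMul, dotProduct, Fin.sum_univ_three] at h
    rw [hXsymm l 2 1, hX12 l] at h
    field_simp
    linarith
  -- normalise the two coefficients to signs
  obtain ⟨ε₁, d₂, hε₁, hd₂, hp⟩ := exists_sign_mul_sq (-b₂ / a)
  obtain ⟨ε₂, d₃, hε₂, hd₃, hq⟩ := exists_sign_mul_sq (-b₃ / a)
  set D : Matrix (Fin 3) (Fin 3) ℝ := diagonal ![1, d₂, d₃] with hDdef
  set G : Matrix (Fin 3) (Fin 3) ℝ := diagonal ![1, d₂⁻¹, d₃⁻¹] with hGdef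
  have hGD : G * D = 1 := by
    rw [hGdef, hDdef, diagonal_mul_diagonal, ← diagonal_one]
    congr 1; funext i; fin_cases i <;> simp [inv_mul_cancel₀ hd₂.ne', inv_mul_cancel₀ hd₃.ne']
  have hDG : D * G = 1 := by
    rw [hGdef, hDdef, diagonal_mul_diagonal, ← diagonal_one]
    congr 1; funext i; fin_cases i <;> simp [mul_inv_cancel₀ hd₂.ne', mul_inv_cancel₀ hd₃.ne']
  set Y : Fin 4 → Matrix (Fin 3) (Fin 3) ℝ := fun l => D * X l * D with hYdef
  have hXY : ∀ l, X l = G * Y l * G := by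
    intro l
    rw [hYdef]
    rw [show G * (D * X l * D) * G = (G * D) * X l * (D * G) by simp only [Matrix.mul_assoc], hGD, hDG,
      Matrix.one_mul, Matrix.mul_one]
  set P : Matrix (Fin 3) (Fin 3) ℝ := G * V with hPdef
  have hPdet : P.det ≠ 0 := by
    rw [hPdef, det_mul, hGdef, det_diagonal]
    refine mul_ne_zero (Finset.prod_ne_zero_iff.mpr fun i _ => ?_) hVdet
    fin_cases i <;> simp [hd₂.ne', hd₃.ne']
  have hSP : ∀ l, S l = Pᵀ * Y l * P := by
    intro l
    rw [hSX, hXY, hPdef, transpose_mul, hGdef, diagonal_transpose]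
    simp only [Matrix.mul_assoc]
  have hYent : ∀ l i j, Y l i j = (![1, d₂, d₃] : Fin 3 → ℝ) i * X l i j * (![1, d₂, d₃] : Fin 3 → ℝ) j := by
    intro l i j
    rw [hYdef]
    simp only
    rw [hDdef, mul_diagonal, diagonal_mul]
  refine ⟨P, ε₁, ε₂, fun l => Y l 1 1, fun l => Y l 2 2, fun l => Y l 0 1, fun l => Y l 0 2, hPdet, hε₁, hε₂, fun l => ?_⟩
  rw [hSP l]
  congr 2
  ext i j
  fin_cases i <;> fin_cases j
  · -- (0,0): `X₀₀ = p X₁₁ + q X₂₂` with `p = ε₁d₂²`, `q = ε₂d₃²`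
    simp only [hYent]
    simp
    rw [hX00 l, hp, hq]
    ring
  · simp
  · simp
  · simp [hYent]
    rw [hXsymm l 1 0]; ring
  · simp
  · simp [hYent, hX12 l]
  · simp [hYent]
    rw [hXsymm l 2 0]; ring
  · simp [hYent, hXsymm l 2 1, hX12 l]
  · simp

/-! ## 6. The frame from a LINE-PAIR PRESENTATION `K = m nᵀ + n mᵀ` of the real line-pair member -/

/-- `tr ((m nᵀ + n mᵀ) S) = 2·mᵀ S n` for symmetric `S`. [folklore] -/
theorem trace_linePair_mul (m n : Fin 3 → ℝ) (T : Matrix (Fin 3) (Fin 3) ℝ) (hT : T.IsSymm) :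
    ((vecMulVec m n + vecMulVec n m) * T).trace = 2 * (m ⬝ᵥ (T *ᵥ n)) := by
  have h10 : T 1 0 = T 0 1 := hT.apply 0 1
  have h20 : T 2 0 = T 0 2 := hT.apply 0 2
  have h21 : T 2 1 = T 1 2 := hT.apply 1 2
  simp [Matrix.trace, Matrix.mul_apply, vecMulVec_apply, dotProduct, Matrix.mulVec, Fin.sum_univ_three]
  rw [h10, h20, h21]
  ring

/-- The line pair `m nᵀ + n mᵀ` is symmetric. [folklore] -/
theorem isSymm_linePair (m n : Fin 3 → ℝ) : (vecMulVec m n + vecMulVec n m).IsSymm := by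
  refine Matrix.IsSymm.ext fun i j => ?_
  simp [vecMulVec_apply]
  ring

/-- **THE HOLLOW-CORNER CHART from a line-pair presentation (ALL node classes, all supports).**  Suppose the annihilator of the
net `span{S₀,…,S₃}` (real symmetric `3 × 3` letters, trace pairing) contains a symmetric `B₁` and a REAL LINE PAIR
`K = m nᵀ + n mᵀ` — i.e. `tr(B₁ S_l) = 0` and `mᵀ S_l n = 0` for every letter (the points `[m], [n]` are conjugate for every
conic of the net) — with the single non-degeneracy `a := (m × n)ᵀ B₁ (m × n) ≠ 0` (the vertex `v = m × n` of the line pair is not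
`B₁`-isotropic; for the annihilator PENCIL this says the real generalised eigenvalue carrying `K` is simple).  Then the explicit frame
`v = m × n`, `w₁ = (B₁v) × m`, `w₂ = (B₁v) × n` (`det = a²`, `w₁ᵀKw₂ = −a²`) feeds `exists_congr_hollowCorner_of_frame`: ONE congruence
brings every letter to hollow-corner form `Pᵀ [[ε₁u_l + ε₂w_l, α_l, β_l], [α_l, u_l, 0], [β_l, 0, w_l]] P`, `εᵢ ∈ {1,0,−1}` fixed.
Which generic nets admit such `(B₁, m, n)`: all of them (classes R4 — three choices —, R2 and R0 — one each: the degenerate members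
of the annihilator pencil at real parameters with a real line pair); that existence statement is standard and NOT proved here. [folklore] -/
theorem exists_congr_hollowCorner (S : Fin 4 → Matrix (Fin 3) (Fin 3) ℝ) (hS : ∀ l, (S l).IsSymm)
    (B₁ : Matrix (Fin 3) (Fin 3) ℝ) (hB₁ : B₁.IsSymm) (m n : Fin 3 → ℝ)
    (hann₁ : ∀ l, (B₁ * S l).trace = 0) (hconj : ∀ l, m ⬝ᵥ (S l *ᵥ n) = 0)
    (ha : (m ⨯₃ n) ⬝ᵥ (B₁ *ᵥ (m ⨯₃ n)) ≠ 0) :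
    ∃ (P : Matrix (Fin 3) (Fin 3) ℝ) (ε₁ ε₂ : ℝ) (u w α β : Fin 4 → ℝ), P.det ≠ 0 ∧
      (ε₁ = 1 ∨ ε₁ = 0 ∨ ε₁ = -1) ∧ (ε₂ = 1 ∨ ε₂ = 0 ∨ ε₂ = -1) ∧
      ∀ l, S l = Pᵀ * !![ε₁ * u l + ε₂ * w l, α l, β l; α l, u l, 0; β l, 0, w l] * P := by
  set K : Matrix (Fin 3) (Fin 3) ℝ := vecMulVec m n + vecMulVec n m with hKdef
  set v : Fin 3 → ℝ := m ⨯₃ n with hvdef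
  set N : Fin 3 → ℝ := B₁ *ᵥ v with hNdef
  set w₁ : Fin 3 → ℝ := N ⨯₃ m with hw₁def
  set w₂ : Fin 3 → ℝ := N ⨯₃ n with hw₂def
  have hsy : ∀ x y : Fin 3 → ℝ, x ⬝ᵥ (B₁ *ᵥ y) = y ⬝ᵥ (B₁ *ᵥ x) :=
    fun x y => by rw [Matrix.dotProduct_mulVec, ← Matrix.mulVec_transpose, hB₁.eq, dotProduct_comm]
  have hKmul : ∀ x : Fin 3 → ℝ, K *ᵥ x = (n ⬝ᵥ x) • m + (m ⬝ᵥ x) • n := by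
    intro x
    ext i
    simp [hKdef, Matrix.mulVec, vecMulVec_apply, dotProduct, Fin.sum_univ_three]
    ring
  have hKv : K *ᵥ v = 0 := by
    rw [hKmul, hvdef, dot_self_cross, dot_cross_self, zero_smul, zero_smul, add_zero]
  have hw₁ : v ⬝ᵥ (B₁ *ᵥ w₁) = 0 := by
    rw [hsy, ← hNdef, hw₁def, dotProduct_comm, dot_self_cross]
  have hw₂ : v ⬝ᵥ (B₁ *ᵥ w₂) = 0 := by
    rw [hsy, ← hNdef, hw₂def, dotProduct_comm, dot_self_cross]
  have hmw₁ : m ⬝ᵥ w₁ = 0 := by rw [hw₁def, dot_cross_self]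
  have hnw₂ : n ⬝ᵥ w₂ = 0 := by rw [hw₂def, dot_cross_self]
  have hiso₁ : w₁ ⬝ᵥ (K *ᵥ w₁) = 0 := by
    rw [hKmul, dotProduct_add, dotProduct_smul, dotProduct_smul, dotProduct_comm w₁ m, hmw₁]; simp
  have hiso₂ : w₂ ⬝ᵥ (K *ᵥ w₂) = 0 := by
    rw [hKmul, dotProduct_add, dotProduct_smul, dotProduct_smul, dotProduct_comm w₂ n, hnw₂]; simp
  -- the two triple products
  have hmw₂ : m ⬝ᵥ w₂ = -(N ⬝ᵥ v) := by
    rw [hw₂def, triple_product_permutation, ← cross_anticomm, dotProduct_neg, ← hvdef]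
  have hnw₁ : n ⬝ᵥ w₁ = N ⬝ᵥ v := by
    rw [hw₁def, triple_product_permutation, ← hvdef]
  have hκ : w₁ ⬝ᵥ (K *ᵥ w₂) = -((N ⬝ᵥ v) * (N ⬝ᵥ v)) := by
    rw [hKmul, dotProduct_add, dotProduct_smul, dotProduct_smul, smul_eq_mul, smul_eq_mul, hnw₂, hmw₂,
      dotProduct_comm w₁ n, hnw₁]
    ring
  have hdetV : (Matrix.of ![v, w₁, w₂]).det = (N ⬝ᵥ v) * (N ⬝ᵥ v) := by
    have h1 : (Matrix.of ![v, w₁, w₂]).det = v ⬝ᵥ (w₁ ⨯₃ w₂) := by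
      rw [triple_product_eq_det]; rfl
    rw [h1, hw₁def, hw₂def, cross_cross_eq_smul_sub_smul, dot_self_cross, zero_smul, zero_sub, ← hw₂def, hmw₂,
      neg_smul, neg_neg, dotProduct_smul, smul_eq_mul, dotProduct_comm v N]
  have hNv : N ⬝ᵥ v ≠ 0 := by rw [dotProduct_comm]; exact ha
  have hV : (Matrix.of ![v, w₁, w₂]).det ≠ 0 := by rw [hdetV]; exact mul_ne_zero hNv hNv
  have hκne : w₁ ⬝ᵥ (K *ᵥ w₂) ≠ 0 := by
    rw [hκ, neg_ne_zero]; exact mul_ne_zero hNv hNv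
  have hannK : ∀ l, (K * S l).trace = 0 := fun l => by
    rw [hKdef, trace_linePair_mul m n (S l) (hS l), hconj l, mul_zero]
  exact exists_congr_hollowCorner_of_frame S hS B₁ K hB₁ (isSymm_linePair m n) hann₁ hannK v w₁ w₂ hV hKv ha hw₁ hw₂
    hiso₁ hiso₂ hκne

/-! ## 7. Census form -/

/-- The hollow-corner chart letters are symmetric. [folklore] -/
theorem isSymm_hollowCorner (e u w α β : ℝ) : (!![e, α, β; α, u, 0; β, 0, w] : Matrix (Fin 3) (Fin 3) ℝ).IsSymm := by
  refine Matrix.IsSymm.ext fun i j => ?_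
  fin_cases i <;> fin_cases j <;> simp

/-- **THE HOLLOW-CORNER CHART THEOREM, census form** (all supports): on any exponent vector `d`, a real symmetric `(3,4)` pencil whose
net is annihilated by a symmetric `B₁` and a real line pair `m nᵀ + n mᵀ` with `(m × n)ᵀB₁(m × n) ≠ 0` has EXACTLY as many distinct
positive det-roots as some hollow-corner pencil `∑_l X^{d_l} [[ε₁u_l+ε₂w_l, α_l, β_l], [α_l, u_l, 0], [β_l, 0, w_l]]` on `d`
(`εᵢ ∈ {1,0,−1}` fixed; sixteen real parameters). [folklore] -/
theorem card_posRoots_eq_hollowCorner (d : Fin 4 → ℕ) (S : Fin 4 → Matrix (Fin 3) (Fin 3) ℝ) (hS : ∀ l, (S l).IsSymm)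
    (B₁ : Matrix (Fin 3) (Fin 3) ℝ) (hB₁ : B₁.IsSymm) (m n : Fin 3 → ℝ)
    (hann₁ : ∀ l, (B₁ * S l).trace = 0) (hconj : ∀ l, m ⬝ᵥ (S l *ᵥ n) = 0)
    (ha : (m ⨯₃ n) ⬝ᵥ (B₁ *ᵥ (m ⨯₃ n)) ≠ 0) :
    ∃ (ε₁ ε₂ : ℝ) (u w α β : Fin 4 → ℝ), (ε₁ = 1 ∨ ε₁ = 0 ∨ ε₁ = -1) ∧ (ε₂ = 1 ∨ ε₂ = 0 ∨ ε₂ = -1) ∧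
      ((Matrix.det (∑ l, ((X : ℝ[X]) ^ d l) • (S l).map C)).roots.toFinset.filter (fun t => 0 < t)).card
        = ((Matrix.det (∑ l, ((X : ℝ[X]) ^ d l) •
            (!![ε₁ * u l + ε₂ * w l, α l, β l; α l, u l, 0; β l, 0, w l] : Matrix (Fin 3) (Fin 3) ℝ).map C)).roots.toFinset.filter
              (fun t => 0 < t)).card := by
  obtain ⟨P, ε₁, ε₂, u, w, α, β, hP, hε₁, hε₂, hSP⟩ := exists_congr_hollowCorner S hS B₁ hB₁ m n hann₁ hconj ha
  refine ⟨ε₁, ε₂, u, w, α, β, hε₁, hε₂, ?_⟩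
  have hPC : (Pᵀ.map C).det = C Pᵀ.det := by rw [← RingHom.mapMatrix_apply, ← RingHom.map_det]
  have hQC : (P.map C).det = C P.det := by rw [← RingHom.mapMatrix_apply, ← RingHom.map_det]
  have hfun : S = fun l => Pᵀ * !![ε₁ * u l + ε₂ * w l, α l, β l; α l, u l, 0; β l, 0, w l] * P := funext hSP
  have hsum : (∑ l, ((X : ℝ[X]) ^ d l) • (S l).map C)
      = Pᵀ.map C * (∑ l, ((X : ℝ[X]) ^ d l) •
          (!![ε₁ * u l + ε₂ * w l, α l, β l; α l, u l, 0; β l, 0, w l] : Matrix (Fin 3) (Fin 3) ℝ).map C) * P.map C := by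
    rw [hfun, Finset.mul_sum, Finset.sum_mul]
    refine Finset.sum_congr rfl fun l _ => ?_
    rw [Matrix.map_mul, Matrix.map_mul, Matrix.mul_smul, Matrix.smul_mul]
  rw [hsum, Matrix.det_mul, Matrix.det_mul, hPC, hQC, det_transpose, mul_comm (C P.det), mul_assoc, ← map_mul,
    mul_comm, Polynomial.roots_C_mul _ (mul_ne_zero hP hP)]

/-- **THE DOOR ON THE LINE-PAIR SECTOR REDUCES TO SIXTEEN-PARAMETER HOLLOW-CORNER ROWS.**  If on `d` every hollow-corner pencil has
`≤ N` distinct positive det-roots then so does every real symmetric `(3,4)` pencil on `d` whose net is annihilated by a symmetric `B₁` and a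
real line pair with non-`B₁`-isotropic vertex. [folklore] -/
theorem card_posRoots_le_of_hollowCorner_rows (d : Fin 4 → ℕ) {N : ℕ}
    (hrows : ∀ (ε₁ ε₂ : ℝ) (u w α β : Fin 4 → ℝ), (ε₁ = 1 ∨ ε₁ = 0 ∨ ε₁ = -1) → (ε₂ = 1 ∨ ε₂ = 0 ∨ ε₂ = -1) →
      ((Matrix.det (∑ l, ((X : ℝ[X]) ^ d l) •
          (!![ε₁ * u l + ε₂ * w l, α l, β l; α l, u l, 0; β l, 0, w l] : Matrix (Fin 3) (Fin 3) ℝ).map C)).roots.toFinset.filter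
            (fun t => 0 < t)).card ≤ N)
    (S : Fin 4 → Matrix (Fin 3) (Fin 3) ℝ) (hS : ∀ l, (S l).IsSymm)
    (B₁ : Matrix (Fin 3) (Fin 3) ℝ) (hB₁ : B₁.IsSymm) (m n : Fin 3 → ℝ)
    (hann₁ : ∀ l, (B₁ * S l).trace = 0) (hconj : ∀ l, m ⬝ᵥ (S l *ᵥ n) = 0)
    (ha : (m ⨯₃ n) ⬝ᵥ (B₁ *ᵥ (m ⨯₃ n)) ≠ 0) :
    ((Matrix.det (∑ l, ((X : ℝ[X]) ^ d l) • (S l).map C)).roots.toFinset.filter (fun t => 0 < t)).card ≤ N := by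
  obtain ⟨ε₁, ε₂, u, w, α, β, hε₁, hε₂, hcard⟩ := card_posRoots_eq_hollowCorner d S hS B₁ hB₁ m n hann₁ hconj ha
  rw [hcard]
  exact hrows ε₁ ε₂ u w α β hε₁ hε₂

/-- Converse bookkeeping: the row `ζ(3,4; d) ≤ B` (in particular `DoorA34`, by `Iff.rfl` the route item
`Theses.LacunarySymmetroid.DoorA34`) contains the hollow-corner rows, since chart pencils ARE symmetric pencils. [folklore] -/
theorem hollowCorner_rows_of_posRootLawOn (d : Fin 4 → ℕ) {B : ℕ} (h : PosRootLawOn 3 4 B d)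
    (ε₁ ε₂ : ℝ) (u w α β : Fin 4 → ℝ) :
    ((Matrix.det (∑ l, ((X : ℝ[X]) ^ d l) •
        (!![ε₁ * u l + ε₂ * w l, α l, β l; α l, u l, 0; β l, 0, w l] : Matrix (Fin 3) (Fin 3) ℝ).map C)).roots.toFinset.filter
          (fun t => 0 < t)).card ≤ B :=
  h _ fun _ => isSymm_hollowCorner _ _ _ _ _

/-- In particular under the cell's typed target `DoorA34 = PosRootLawAt 3 4 18` every hollow-corner pencil has `≤ 18` distinct positive
det-roots on every support. [folklore] -/
theorem hollowCorner_rows_of_doorA34 (h : DoorA34) (d : Fin 4 → ℕ) (ε₁ ε₂ : ℝ) (u w α β : Fin 4 → ℝ) :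
    ((Matrix.det (∑ l, ((X : ℝ[X]) ^ d l) •
        (!![ε₁ * u l + ε₂ * w l, α l, β l; α l, u l, 0; β l, 0, w l] : Matrix (Fin 3) (Fin 3) ℝ).map C)).roots.toFinset.filter
          (fun t => 0 < t)).card ≤ 18 :=
  h d _ fun _ => isSymm_hollowCorner _ _ _ _ _

end Summit.ValiantsHypothesis.ValiantsHypothesis.Theorems.LacunarySymmetroidMatrixDescartes.Census.EqualDiagonal
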